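import Summits.BirchSwinnertonDyer.BirchSwinnertonDyer.Theorems.EisensteinPrimesLocallyTrivialConjIndex
import Summits.BirchSwinnertonDyer.Rank1Residual.Iwasawa.InertiaCohomologyPTorsionFinite
import Literature.NumberTheory.EllipticCurves.GreenbergVatsal2000.GreenbergSelmerGroups
import HarnessLib

/-!
# "Unramified ⇒ locally trivial above `w` over `K_∞`": `unramifiedKer (ker κ) M w ≤ awayKer (ker κ) M w`
# at a finitely decomposed `w ∤ p` of a `ℤ_p`-extension, for a `p`-primary discrete module — the
# hypothesis `hUT` of `SelmerAcQuotientCorankLeGeneric.zpCorank_selmerOver_quotient_le_sum`, DISCHARGED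

Cell `bsd-eis` (home `run/shared/lean/pub/bsd-eis/`), seat `bsd-line-x1-p1-w2` (D-0154 width seat on
crux 2 `GoodLatticeBDPValue` = stmt-BirchSwinnertonDyer-19032, line `halves` v14, stub
`stub_imprimCorank`, `f`-side conjunct `rem142_goodLattice_selmerAc_imprimitive`), file F2 of its
unconditional `≤`-half. The one displayed hypothesis of F1 (p610683: the quotient corank bound for
Castella's `Sel_𝔭^{S₀}/Sel_𝔭^∅`, whose local condition away from `p` is TRIVIALITY on `H ⊓ D_w`, read
through the INERTIA restrictions) is that unramified classes are locally trivial above `w` over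
`K_∞ = K̄^{ker κ}`. This holds whenever `w ∤ p` is finitely decomposed in `K_∞` (`κ(D_w) ≠ 1`,
`κ(I_w) = 1`): the quotient `Gal(K̄_w/K_{∞,η}) / I_{K_w}` is then the prime-to-`p` part of `Ẑ`, of
`p`-cohomological dimension `0` on `p`-primary modules. The kernel engine is the cell's brick
`GreenbergFullAtSelmer.resH1Hom_decompIn_eq_zero_of_mem_unramifiedKer_of_character` (k5-c2 g9,
written for the `ℤ_p²`-tower `pairKer κ₁ κ₂` with an auxiliary character `κ₃`); this file is the
ONE-variable instance `κ₁ = κ₂ = κ₃ = κ` (`pairKer κ κ = ker κ ⊓ ker κ`), with the plumbing between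
`H¹(ker κ ⊓ ker κ, M)` and `H¹(ker κ, M)` (restriction along the two inclusions, `resH1Hom_comp`).

* `unramifiedKer_le_awayKer_of_not_decomp_le` — for `K : Type`, any `ℤ_p`-extension `κ`, any `w`
  with `I_w ≤ ker κ` and `D_w ⊄ ker κ`, any discrete `p`-primary `M` with open stabilisers:
  `unramifiedKer κ.kerSubgroup M w ≤ awayKer κ.kerSubgroup M w`.

HONEST FRAMING: tool theorem only (no definition, no named fact, no `sorry`); closes nothing by itself
(`--supports stmt-BirchSwinnertonDyer-19032`); BSD / Mazur's main conjecture is proved for no curve.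

References: Greenberg 1989 §1 p. 98 ("`D_v/I_v` has (profinite) order prime to `p`"); Greenberg–Vatsal
2000 §2 p. 17; Serre, *Galois Cohomology* I §2.4 Prop. 9; Keller–Yin arXiv:2402.12781v2 Rem. 1.2.3 (i)
("the unramified and the strict conditions coincide at the split `w ∈ Σ ∖ p`").
-/

-- `Summit.BirchSwinnertonDyer.BirchSwinnertonDyer.…`: summit and sub-problem share a name (D-0017 layout).
set_option linter.dupNamespace false
set_option autoImplicit false

noncomputable section

open scoped Classical

open NumberField IsDedekindDomain Field
open Literature.NumberTheory.EllipticCurves Literature.NumberTheory.EllipticCurves.GreenbergSelmer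
  Literature.NumberTheory.EllipticCurves.GreenbergVatsal2000 Literature.NumberTheory.GaloisRepresentations
  Summit.BirchSwinnertonDyer.Rank1Residual

namespace Summit.BirchSwinnertonDyer.BirchSwinnertonDyer.Theorems.UnramifiedLeAwayKer

variable {K : Type} [Field K] [NumberField K] {p : ℕ} [Fact p.Prime] (κ : ZpExtension K p)
  {M : Type} [AddCommGroup M] [DistribMulAction (absoluteGaloisGroup K) M] [TopologicalSpace M]
  [DiscreteTopology M]

/-- **Unramified ⇒ locally trivial above a finitely decomposed `w ∤ p` over `K_∞`**: for a
`ℤ_p`-extension `κ` with `I_w ≤ ker κ` (e.g. `w ∤ p`) and `D_w ⊄ ker κ` (`w` finitely decomposed in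
`K_∞`), and a discrete `p`-primary `Γ_K`-module `M` with open stabilisers, every class of
`H¹(Gal(K̄/K_∞), M)` unramified at the chosen place above `w` is locally trivial there:
`unramifiedKer (ker κ) M w ≤ awayKer (ker κ) M w`. (`Gal(K̄_w/K_{∞,η}) / I_{K_w}` is pro-prime-to-`p`;
ONE-variable instance `κ₁ = κ₂ = κ₃ = κ` of the cell's two-variable brick
`resH1Hom_decompIn_eq_zero_of_mem_unramifiedKer_of_character`.) Greenberg 1989 p. 98: "one could
replace `I_v` by `D_v` since `D_v/I_v` has (profinite) order prime to `p`"; KY Rem. 1.2.3 (i).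
[cite: Greenberg1989, §1 p. 98] [cite: GreenbergVatsal2000, §2 p. 17]
[cite: KellerYin2024, Rem. 1.2.3 (i) (arXiv:2402.12781v2 TeX L685–690)] -/
theorem unramifiedKer_le_awayKer_of_not_decomp_le
    (hstab : ∀ m : M, IsOpen (MulAction.stabilizer (absoluteGaloisGroup K) m : Set (absoluteGaloisGroup K)))
    (hM : ∀ m : M, ∃ k : ℕ, p ^ k • m = 0) {w : HeightOneSpectrum (𝓞 K)}
    (hI : inertia (K := K) w ≤ κ.kerSubgroup) (hD : ¬ decomp (K := K) w ≤ κ.kerSubgroup) :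
    unramifiedKer κ.kerSubgroup M w ≤ awayKer κ.kerSubgroup M w := by
  intro x hx
  -- the two-variable vocabulary at `κ₁ = κ₂ = κ`: `pairKer κ κ = ker κ ⊓ ker κ ≤ ker κ`
  have hPle : ZpExtension.pairKer κ κ ≤ κ.kerSubgroup := ZpExtension.pairKer_le_left κ κ
  -- (1) `res_{pairKer} x` is unramified at `w`
  have hyunr : resOfLe M hPle x ∈ unramifiedKer (ZpExtension.pairKer κ κ) M w := by
    -- the inclusion `inertiaIn (pairKer κ κ) w → inertiaIn (ker κ) w`
    let j : inertiaIn (ZpExtension.pairKer κ κ) w →ₜ* inertiaIn κ.kerSubgroup w :=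
      { toFun := fun z ↦ ⟨(z : decomp (K := K) w), (mem_inertiaIn_iff κ.kerSubgroup w _).2
          ⟨hPle ((mem_inertiaIn_iff (ZpExtension.pairKer κ κ) w _).1 z.2).1,
            ((mem_inertiaIn_iff (ZpExtension.pairKer κ κ) w _).1 z.2).2⟩⟩
        map_one' := rfl
        map_mul' := fun _ _ ↦ rfl
        continuous_toFun := continuous_subtype_val.subtype_mk _ }
    have hfac : (resH1Hom (inertiaInToH (ZpExtension.pairKer κ κ) w) (AddMonoidHom.id M)
          fun _ _ ↦ rfl).comp (resOfLe M hPle) =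
        (resH1Hom j (AddMonoidHom.id M) fun _ _ ↦ rfl).comp
          (resH1Hom (inertiaInToH κ.kerSubgroup w) (AddMonoidHom.id M) fun _ _ ↦ rfl) := by
      rw [resOfLe, resH1Hom_comp, resH1Hom_comp]
      exact resH1Hom_congr (by ext; rfl) (by ext; rfl) _ _
    have hx0 : resH1Hom (inertiaInToH κ.kerSubgroup w) (AddMonoidHom.id M) (fun _ _ ↦ rfl) x = 0 := hx
    change resH1Hom (inertiaInToH (ZpExtension.pairKer κ κ) w) (AddMonoidHom.id M) (fun _ _ ↦ rfl)
      (resOfLe M hPle x) = 0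
    rw [← AddMonoidHom.comp_apply, hfac, AddMonoidHom.comp_apply, hx0, map_zero]
  -- (2) the brick: `res_{pairKer} x` dies on `decompIn (pairKer κ κ) w`
  have h0 := GreenbergFullAtSelmer.resH1Hom_decompIn_eq_zero_of_mem_unramifiedKer_of_character κ κ
    hstab hM κ hI hD hPle (resOfLe M hPle x) hyunr
  -- (3) transport to `res_{ker κ ⊓ D_w} x = 0` along the surjection `decompIn (pairKer κ κ) w ↠ ker κ ⊓ D_w`
  let e : decompIn (ZpExtension.pairKer κ κ) w →ₜ* ↥(κ.kerSubgroup ⊓ decomp (K := K) w) :=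
    { toFun := fun z ↦ ⟨((z : decomp (K := K) w) : absoluteGaloisGroup K),
        Subgroup.mem_inf.2 ⟨hPle ((mem_decompIn_iff (ZpExtension.pairKer κ κ) w _).1 z.2),
          (z : decomp (K := K) w).2⟩⟩
      map_one' := rfl
      map_mul' := fun _ _ ↦ rfl
      continuous_toFun := (continuous_subtype_val.comp continuous_subtype_val).subtype_mk _ }
  have he : Function.Surjective e := by
    rintro ⟨z, hz⟩
    obtain ⟨hzk, hzD⟩ := Subgroup.mem_inf.1 hz
    exact ⟨⟨⟨z, hzD⟩, (mem_decompIn_iff (ZpExtension.pairKer κ κ) w _).2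
      (Subgroup.mem_inf.2 ⟨hzk, hzk⟩)⟩, rfl⟩
  have hinj := Iwasawa.resH1Hom_injective_of_surjective (M := M) e he fun _ _ ↦ rfl
  have hfac2 : (resH1Hom e (AddMonoidHom.id M) fun _ _ ↦ rfl).comp
        (resOfLe M (inf_le_left : κ.kerSubgroup ⊓ decomp (K := K) w ≤ κ.kerSubgroup)) =
      (resH1Hom (decompInToH (ZpExtension.pairKer κ κ) w) (AddMonoidHom.id M) fun _ _ ↦ rfl).comp
        (resOfLe M hPle) := by
    rw [resOfLe, resOfLe, resH1Hom_comp, resH1Hom_comp]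
    exact resH1Hom_congr (by ext; rfl) (by ext; rfl) _ _
  have hgoal : resOfLe M (inf_le_left : κ.kerSubgroup ⊓ decomp (K := K) w ≤ κ.kerSubgroup) x = 0 := by
    apply hinj
    rw [map_zero, ← AddMonoidHom.comp_apply, hfac2, AddMonoidHom.comp_apply, h0]
  exact hgoal

end Summit.BirchSwinnertonDyer.BirchSwinnertonDyer.Theorems.UnramifiedLeAwayKer

end
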